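import Literature.Analysis.ValidatedNumerics.TaylorModelLogEdge
import HarnessLib

/-!
# The `L²` norm over a panel of a function that switches branch at an enclosed breakpoint

Trunk T-ANA (Analysis/ValidatedNumerics); namespace `Literature.Analysis.ValidatedNumerics.PolyMP`.
Sequel of `TaylorModelL2.lean` / `TaylorModelLogEdge.lean` (`integral_sq_le_of_tmem_sub`).  On a panel `|ρ| ≤ h` let
`R = R_A` on `[-h, β]` and `R = R_B` on `[β, h]`, where the breakpoint `β` is only known to lie in a rational bracket
`[b⁻, b⁺] ⊆ [-h, h]` (e.g. `β = log n − c − y_k`, an enclosed irrational), and let `R_A`, `R_B` be Taylor-modelled on the WHOLE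
panel (`P_A`, `P_B`, reference polynomials `p_A`, `p_B`).  Since the pointwise majorants `p² + (2‖p‖δ + δ²)` are non-negative,
each piece may be integrated over the LARGER rational interval, giving the kernel-decidable bound

  `∫_{-h}^{h} R² ≤ sqIntegSubQ S h P_A p_A (−h) b⁺ + sqIntegSubQ S h P_B p_B b⁻ h`      (`integral_sq_split_le`),

`sqIntegSubQ S h P p a b = [∫_a^b p²] + (b − a)(2‖p‖_h δ + δ²)` (exact over `ℚ`); `integral_sq_split_le_Ioo` is the version asking
`R = R_A`, `R = R_B` only on the open pieces `(-h, β)`, `(β, h)`.  Used for the y-panels of a window image that contain a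
switch-on point of a shifted prime copy.  Problem-independent; no facts, no axioms.

## References

* K. Makino, M. Berz, Int. J. Pure Appl. Math. 4 (2003) 379–456, §6. [folklore]
-/

open MeasureTheory intervalIntegral Set
open scoped Interval

namespace Literature.Analysis.ValidatedNumerics

namespace PolyMP

open Literature.Analysis.ValidatedNumerics.NumericsMP
open Literature.Analysis.ValidatedNumerics.ExpPoly (Poly)
open Literature.Analysis.ValidatedNumerics.ExpPoly

/-- `[∫_a^b p²] + (b − a)(2‖p‖_h δ + δ²)` over `ℚ`, `δ = tabsI S h (P − p)/S`. [folklore] -/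
def sqIntegSubQ (S : ℕ) (h : ℚ) (P : IPoly) (p : Poly) (a b : ℚ) : ℚ :=
  (Poly.evalQ (Poly.ad 0 (Poly.mul p p)) b - Poly.evalQ (Poly.ad 0 (Poly.mul p p)) a) +
    (b - a) * (2 * absBoundQ p h * ((tabsI S h (tsubI P (ratPolyI S p)) : ℚ) / S) +
      (((tabsI S h (tsubI P (ratPolyI S p)) : ℚ) / S) ^ 2))

/-- The pointwise majorant integrated over a rational sub-interval equals `sqIntegSubQ`. [folklore] -/
theorem integral_majorant_eq_sqIntegSubQ (S : ℕ) (h : ℚ) (P : IPoly) (p : Poly) (a b : ℚ) :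
    ∫ ρ in (a : ℝ)..b, (Poly.eval p ρ ^ 2 +
      (2 * absBoundQ p h * ((tabsI S h (tsubI P (ratPolyI S p)) : ℝ) / S) +
        ((tabsI S h (tsubI P (ratPolyI S p)) : ℝ) / S) ^ 2)) = ((sqIntegSubQ S h P p a b : ℚ) : ℝ) := by
  set K : ℝ := 2 * absBoundQ p h * ((tabsI S h (tsubI P (ratPolyI S p)) : ℝ) / S) +
    ((tabsI S h (tsubI P (ratPolyI S p)) : ℝ) / S) ^ 2 with hK
  rw [intervalIntegral.integral_add (f := fun ρ => Poly.eval p ρ ^ 2) (g := fun _ => K)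
    (((Poly.continuous_eval p).pow 2).intervalIntegrable _ _) (continuous_const.intervalIntegrable _ _),
    intervalIntegral.integral_const, smul_eq_mul]
  have hp2 : ∫ ρ in (a : ℝ)..b, Poly.eval p ρ ^ 2 =
      Poly.eval (Poly.ad 0 (Poly.mul p p)) b - Poly.eval (Poly.ad 0 (Poly.mul p p)) a := by
    rw [← integral_eq_sub_of_hasDerivAt (fun x _ => hasDerivAt_eval_ad_zero (Poly.mul p p) x)
      ((Poly.continuous_eval _).intervalIntegrable _ _)]
    exact intervalIntegral.integral_congr fun ρ _ => by simp only [Poly.eval_mul, pow_two]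
  rw [hp2, sqIntegSubQ, hK]
  have e1 := Poly.eval_evalQ (Poly.ad 0 (Poly.mul p p)) b
  have e2 := Poly.eval_evalQ (Poly.ad 0 (Poly.mul p p)) a
  push_cast
  linarith [e1, e2]

/-- One branch: `∫_u^v R² ≤ sqIntegSubQ … a b` whenever `R = R_X` on `[u, v] ⊆ [a, b] ⊆ [-h, h]` and `R_X` is Taylor-modelled.
[folklore] -/
theorem integral_sq_branch_le {S : ℕ} (hS : 0 < S) {h : ℚ} (h0 : 0 ≤ h) {R RX : ℝ → ℝ} {P : IPoly}
    (hX : TMem S h RX P) (p : Poly) {u v : ℝ} {a b : ℚ} (ha : -(h : ℝ) ≤ a) (hau : (a : ℝ) ≤ u) (huv : u ≤ v)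
    (hvb : v ≤ b) (hb : (b : ℝ) ≤ h) (hR : ∀ ρ ∈ Icc u v, R ρ = RX ρ)
    (hRi : IntervalIntegrable (fun ρ => R ρ ^ 2) volume u v) :
    ∫ ρ in u..v, R ρ ^ 2 ≤ ((sqIntegSubQ S h P p a b : ℚ) : ℝ) := by
  set δ : ℝ := (tabsI S h (tsubI P (ratPolyI S p)) : ℝ) / S with hδ
  set K : ℝ := 2 * absBoundQ p h * δ + δ ^ 2 with hK
  have hhr : (0 : ℝ) ≤ h := by exact_mod_cast h0
  have hδ0 : 0 ≤ δ := (abs_nonneg _).trans (abs_sub_poly_le_of_tmem hS h0 hX p (by rw [abs_zero]; exact hhr))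
  have hA0 : 0 ≤ (absBoundQ p h : ℝ) := (abs_nonneg _).trans (abs_eval_le_absBoundQ p (by rw [abs_zero]; exact hhr))
  have hK0 : 0 ≤ K := by rw [hK]; positivity
  have hmc : Continuous fun ρ => Poly.eval p ρ ^ 2 + K := ((Poly.continuous_eval p).pow 2).add continuous_const
  -- pointwise on `[u, v]`
  have h1 : ∫ ρ in u..v, R ρ ^ 2 ≤ ∫ ρ in u..v, (Poly.eval p ρ ^ 2 + K) := by
    refine intervalIntegral.integral_mono_on huv hRi (hmc.intervalIntegrable _ _) fun ρ hρ => ?_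
    rw [hR ρ hρ]
    exact sq_le_of_tmem hS h0 hX p (abs_le.2 ⟨by linarith [hρ.1], by linarith [hρ.2]⟩)
  -- enlarge the interval (non-negative integrand)
  have h2 : ∫ ρ in u..v, (Poly.eval p ρ ^ 2 + K) ≤ ∫ ρ in (a : ℝ)..b, (Poly.eval p ρ ^ 2 + K) :=
    intervalIntegral.integral_mono_interval hau huv hvb
      (Filter.Eventually.of_forall fun ρ => by positivity) (hmc.intervalIntegrable _ _)
  exact (h1.trans h2).trans (le_of_eq (integral_majorant_eq_sqIntegSubQ S h P p a b))

/-- **Panel with an enclosed breakpoint.**  `R = R_A` on `[-h, β]`, `R = R_B` on `[β, h]`, `b⁻ ≤ β ≤ b⁺` rational in `[-h, h]`,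
`R_A`, `R_B` Taylor-modelled on the whole panel, `R²` interval integrable: then
`∫_{-h}^{h} R² ≤ sqIntegSubQ S h P_A p_A (−h) b⁺ + sqIntegSubQ S h P_B p_B b⁻ h`. [folklore] -/
theorem integral_sq_split_le {S : ℕ} (hS : 0 < S) {h : ℚ} (h0 : 0 ≤ h) {R RA RB : ℝ → ℝ} {PA PB : IPoly}
    (hA : TMem S h RA PA) (hB : TMem S h RB PB) (pA pB : Poly) {β : ℝ} {bm bp : ℚ}
    (hbm : -h ≤ bm) (hbmβ : (bm : ℝ) ≤ β) (hβbp : β ≤ bp) (hbp : bp ≤ h)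
    (hRA : ∀ ρ ∈ Icc (-(h : ℝ)) β, R ρ = RA ρ) (hRB : ∀ ρ ∈ Icc β h, R ρ = RB ρ)
    (hRi : IntervalIntegrable (fun ρ => R ρ ^ 2) volume (-(h : ℝ)) h) :
    ∫ ρ in (-(h : ℝ))..h, R ρ ^ 2 ≤
      ((sqIntegSubQ S h PA pA (-h) bp : ℚ) : ℝ) + ((sqIntegSubQ S h PB pB bm h : ℚ) : ℝ) := by
  have hbm' : (-(h : ℝ)) ≤ bm := by exact_mod_cast hbm
  have hbp' : ((bp : ℚ) : ℝ) ≤ h := by exact_mod_cast hbp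
  have hβ1 : -(h : ℝ) ≤ β := hbm'.trans hbmβ
  have hβ2 : β ≤ h := hβbp.trans hbp'
  have hIA : IntervalIntegrable (fun ρ => R ρ ^ 2) volume (-(h : ℝ)) β :=
    hRi.mono_set (by rw [uIcc_of_le hβ1, uIcc_of_le (hβ1.trans hβ2)]; exact Icc_subset_Icc le_rfl hβ2)
  have hIB : IntervalIntegrable (fun ρ => R ρ ^ 2) volume β h :=
    hRi.mono_set (by rw [uIcc_of_le hβ2, uIcc_of_le (hβ1.trans hβ2)]; exact Icc_subset_Icc hβ1 le_rfl)
  rw [← integral_add_adjacent_intervals hIA hIB]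
  refine add_le_add ?_ ?_
  · have := integral_sq_branch_le hS h0 hA pA (a := -h) (b := bp) (by push_cast; exact le_rfl)
      (by push_cast; exact le_rfl) hβ1 hβbp hbp' hRA hIA
    simpa using this
  · exact integral_sq_branch_le hS h0 hB pB (a := bm) (b := h) hbm' hbmβ hβ2 le_rfl le_rfl hRB hIB

/-- One branch, open-interval version: `∫_u^v R² ≤ sqIntegSubQ … a b` whenever `R = R_X` on the OPEN interval `(u, v)`,
`[u, v] ⊆ [a, b] ⊆ [-h, h]`, and `R_X` is Taylor-modelled (the endpoints are Lebesgue-null, so a switch exactly at `u` or `v` is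
harmless). [folklore] -/
theorem integral_sq_branch_le_Ioo {S : ℕ} (hS : 0 < S) {h : ℚ} (h0 : 0 ≤ h) {R RX : ℝ → ℝ} {P : IPoly}
    (hX : TMem S h RX P) (p : Poly) {u v : ℝ} {a b : ℚ} (ha : -(h : ℝ) ≤ a) (hau : (a : ℝ) ≤ u) (huv : u ≤ v)
    (hvb : v ≤ b) (hb : (b : ℝ) ≤ h) (hR : ∀ ρ ∈ Ioo u v, R ρ = RX ρ)
    (hRi : IntervalIntegrable (fun ρ => R ρ ^ 2) volume u v) :
    ∫ ρ in u..v, R ρ ^ 2 ≤ ((sqIntegSubQ S h P p a b : ℚ) : ℝ) := by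
  set δ : ℝ := (tabsI S h (tsubI P (ratPolyI S p)) : ℝ) / S with hδ
  set K : ℝ := 2 * absBoundQ p h * δ + δ ^ 2 with hK
  have hhr : (0 : ℝ) ≤ h := by exact_mod_cast h0
  have hδ0 : 0 ≤ δ := (abs_nonneg _).trans (abs_sub_poly_le_of_tmem hS h0 hX p (by rw [abs_zero]; exact hhr))
  have hA0 : 0 ≤ (absBoundQ p h : ℝ) := (abs_nonneg _).trans (abs_eval_le_absBoundQ p (by rw [abs_zero]; exact hhr))
  have hK0 : 0 ≤ K := by rw [hK]; positivity
  have hmc : Continuous fun ρ => Poly.eval p ρ ^ 2 + K := ((Poly.continuous_eval p).pow 2).add continuous_const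
  -- pointwise on `(u, v)`
  have h1 : ∫ ρ in u..v, R ρ ^ 2 ≤ ∫ ρ in u..v, (Poly.eval p ρ ^ 2 + K) := by
    refine intervalIntegral.integral_mono_on_of_le_Ioo huv hRi (hmc.intervalIntegrable _ _) fun ρ hρ => ?_
    rw [hR ρ hρ]
    exact sq_le_of_tmem hS h0 hX p (abs_le.2 ⟨by linarith [hρ.1], by linarith [hρ.2]⟩)
  -- enlarge the interval (non-negative integrand)
  have h2 : ∫ ρ in u..v, (Poly.eval p ρ ^ 2 + K) ≤ ∫ ρ in (a : ℝ)..b, (Poly.eval p ρ ^ 2 + K) :=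
    intervalIntegral.integral_mono_interval hau huv hvb
      (Filter.Eventually.of_forall fun ρ => by positivity) (hmc.intervalIntegrable _ _)
  exact (h1.trans h2).trans (le_of_eq (integral_majorant_eq_sqIntegSubQ S h P p a b))

/-- **Panel with an enclosed breakpoint, open-interval version.**  `R = R_A` on `(-h, β)`, `R = R_B` on `(β, h)` (nothing is
required at `β` itself or at `±h`), `b⁻ ≤ β ≤ b⁺` rational in `[-h, h]`, `R_A`, `R_B` Taylor-modelled on the whole panel, `R²` interval
integrable: then `∫_{-h}^{h} R² ≤ sqIntegSubQ S h P_A p_A (−h) b⁺ + sqIntegSubQ S h P_B p_B b⁻ h`. [folklore] -/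
theorem integral_sq_split_le_Ioo {S : ℕ} (hS : 0 < S) {h : ℚ} (h0 : 0 ≤ h) {R RA RB : ℝ → ℝ} {PA PB : IPoly}
    (hA : TMem S h RA PA) (hB : TMem S h RB PB) (pA pB : Poly) {β : ℝ} {bm bp : ℚ}
    (hbm : -h ≤ bm) (hbmβ : (bm : ℝ) ≤ β) (hβbp : β ≤ bp) (hbp : bp ≤ h)
    (hRA : ∀ ρ ∈ Ioo (-(h : ℝ)) β, R ρ = RA ρ) (hRB : ∀ ρ ∈ Ioo β h, R ρ = RB ρ)
    (hRi : IntervalIntegrable (fun ρ => R ρ ^ 2) volume (-(h : ℝ)) h) :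
    ∫ ρ in (-(h : ℝ))..h, R ρ ^ 2 ≤
      ((sqIntegSubQ S h PA pA (-h) bp : ℚ) : ℝ) + ((sqIntegSubQ S h PB pB bm h : ℚ) : ℝ) := by
  have hbm' : (-(h : ℝ)) ≤ bm := by exact_mod_cast hbm
  have hbp' : ((bp : ℚ) : ℝ) ≤ h := by exact_mod_cast hbp
  have hβ1 : -(h : ℝ) ≤ β := hbm'.trans hbmβ
  have hβ2 : β ≤ h := hβbp.trans hbp'
  have hIA : IntervalIntegrable (fun ρ => R ρ ^ 2) volume (-(h : ℝ)) β :=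
    hRi.mono_set (by rw [uIcc_of_le hβ1, uIcc_of_le (hβ1.trans hβ2)]; exact Icc_subset_Icc le_rfl hβ2)
  have hIB : IntervalIntegrable (fun ρ => R ρ ^ 2) volume β h :=
    hRi.mono_set (by rw [uIcc_of_le hβ2, uIcc_of_le (hβ1.trans hβ2)]; exact Icc_subset_Icc hβ1 le_rfl)
  rw [← integral_add_adjacent_intervals hIA hIB]
  refine add_le_add ?_ ?_
  · have := integral_sq_branch_le_Ioo hS h0 hA pA (a := -h) (b := bp) (by push_cast; exact le_rfl)
      (by push_cast; exact le_rfl) hβ1 hβbp hbp' hRA hIA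
    simpa using this
  · exact integral_sq_branch_le_Ioo hS h0 hB pB (a := bm) (b := h) hbm' hbmβ hβ2 le_rfl le_rfl hRB hIB

/-! ## Localised error term: `‖p‖` over the sub-interval only

On a split panel one flag configuration continues the polynomial copy of a prime slot OUTSIDE the window, where a
high-degree window polynomial explodes; the global `‖p‖_h` then ruins the error term `2‖p‖δ`.  The variants below use
`‖p‖` over `[a, b]` only (re-centred at the midpoint via `Poly.shift`). -/

/-- `[∫_a^b p²] + (b − a)(2‖p‖_{[a,b]} δ + δ²)`, `‖p‖_{[a,b]} = absBoundQ (shift p ((a+b)/2)) ((b−a)/2)`. [folklore] -/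
def sqIntegSubLocQ (S : ℕ) (h : ℚ) (P : IPoly) (p : Poly) (a b : ℚ) : ℚ :=
  (Poly.evalQ (Poly.ad 0 (Poly.mul p p)) b - Poly.evalQ (Poly.ad 0 (Poly.mul p p)) a) +
    (b - a) * (2 * absBoundQ (Poly.shift p ((a + b) / 2)) ((b - a) / 2) * ((tabsI S h (tsubI P (ratPolyI S p)) : ℚ) / S) +
      (((tabsI S h (tsubI P (ratPolyI S p)) : ℚ) / S) ^ 2))

/-- `|p(ρ)| ≤ ‖p‖_{[a,b]}` for `ρ ∈ [a, b]`. [folklore] -/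
theorem abs_eval_le_absBoundQ_loc (p : Poly) {a b : ℚ} {ρ : ℝ} (h1 : (a : ℝ) ≤ ρ) (h2 : ρ ≤ b) :
    |Poly.eval p ρ| ≤ (absBoundQ (Poly.shift p ((a + b) / 2)) ((b - a) / 2) : ℝ) := by
  have e : Poly.eval p ρ = Poly.eval (Poly.shift p ((a + b) / 2)) ((((a + b) / 2 : ℚ) : ℝ) - ρ) := by
    rw [eval_shift_eq]; congr 1; ring
  rw [e]
  refine abs_eval_le_absBoundQ _ (abs_le.2 ⟨?_, ?_⟩) <;> push_cast <;> linarith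

/-- One branch with the localised error term (open-interval version). [folklore] -/
theorem integral_sq_branch_le_Ioo_loc {S : ℕ} (hS : 0 < S) {h : ℚ} (h0 : 0 ≤ h) {R RX : ℝ → ℝ} {P : IPoly}
    (hX : TMem S h RX P) (p : Poly) {u v : ℝ} {a b : ℚ} (ha : -(h : ℝ) ≤ a) (hau : (a : ℝ) ≤ u) (huv : u ≤ v)
    (hvb : v ≤ b) (hb : (b : ℝ) ≤ h) (hR : ∀ ρ ∈ Ioo u v, R ρ = RX ρ)
    (hRi : IntervalIntegrable (fun ρ => R ρ ^ 2) volume u v) :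
    ∫ ρ in u..v, R ρ ^ 2 ≤ ((sqIntegSubLocQ S h P p a b : ℚ) : ℝ) := by
  set δ : ℝ := (tabsI S h (tsubI P (ratPolyI S p)) : ℝ) / S with hδ
  set A : ℝ := (absBoundQ (Poly.shift p ((a + b) / 2)) ((b - a) / 2) : ℝ) with hAdef
  set K : ℝ := 2 * A * δ + δ ^ 2 with hK
  have hhr : (0 : ℝ) ≤ h := by exact_mod_cast h0
  have hδ0 : 0 ≤ δ := (abs_nonneg _).trans (abs_sub_poly_le_of_tmem hS h0 hX p (by rw [abs_zero]; exact hhr))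
  have hmc : Continuous fun ρ => Poly.eval p ρ ^ 2 + K := ((Poly.continuous_eval p).pow 2).add continuous_const
  -- pointwise on `(u, v)`
  have hpt : ∀ ρ ∈ Ioo u v, R ρ ^ 2 ≤ Poly.eval p ρ ^ 2 + K := by
    intro ρ hρ
    rw [hR ρ hρ]
    have hρh : |ρ| ≤ h := abs_le.2 ⟨by linarith [hρ.1], by linarith [hρ.2]⟩
    have hd := abs_sub_poly_le_of_tmem hS h0 hX p hρh
    have hpA : |Poly.eval p ρ| ≤ A := abs_eval_le_absBoundQ_loc p (by linarith [hρ.1]) (by linarith [hρ.2])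
    have hA0 : 0 ≤ A := (abs_nonneg _).trans hpA
    have e : RX ρ = Poly.eval p ρ + (RX ρ - Poly.eval p ρ) := by ring
    rw [e, hK]
    have h3 : |RX ρ - Poly.eval p ρ| ≤ δ := hd
    nlinarith [abs_le.1 h3, abs_le.1 hpA, abs_nonneg (RX ρ - Poly.eval p ρ), sq_abs (RX ρ - Poly.eval p ρ),
      abs_mul_abs_self (Poly.eval p ρ), mul_le_mul hpA h3 (abs_nonneg _) hA0, abs_mul (Poly.eval p ρ) (RX ρ - Poly.eval p ρ),
      le_abs_self (Poly.eval p ρ * (RX ρ - Poly.eval p ρ))]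
  have hK0 : 0 ≤ K := by
    rcases lt_or_ge u v with huv' | hvu
    · obtain ⟨ρ, hρ⟩ : (Ioo u v).Nonempty := nonempty_Ioo.2 huv'
      have hpA : |Poly.eval p ρ| ≤ A := abs_eval_le_absBoundQ_loc p (by linarith [hρ.1]) (by linarith [hρ.2])
      have hA0 : 0 ≤ A := (abs_nonneg _).trans hpA
      rw [hK]; positivity
    · -- degenerate interval: K's sign is irrelevant, but we still need it below; use a ≤ b route
      have hab : (a : ℝ) ≤ b := hau.trans (huv.trans hvb)
      have hpA : |Poly.eval p (a : ℝ)| ≤ A := abs_eval_le_absBoundQ_loc p le_rfl hab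
      have hA0 : 0 ≤ A := (abs_nonneg _).trans hpA
      rw [hK]; positivity
  have h1 : ∫ ρ in u..v, R ρ ^ 2 ≤ ∫ ρ in u..v, (Poly.eval p ρ ^ 2 + K) :=
    intervalIntegral.integral_mono_on_of_le_Ioo huv hRi (hmc.intervalIntegrable _ _) hpt
  have h2 : ∫ ρ in u..v, (Poly.eval p ρ ^ 2 + K) ≤ ∫ ρ in (a : ℝ)..b, (Poly.eval p ρ ^ 2 + K) :=
    intervalIntegral.integral_mono_interval hau huv hvb
      (Filter.Eventually.of_forall fun ρ => by positivity) (hmc.intervalIntegrable _ _)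
  have h3 : ∫ ρ in (a : ℝ)..b, (Poly.eval p ρ ^ 2 + K) = ((sqIntegSubLocQ S h P p a b : ℚ) : ℝ) := by
    rw [intervalIntegral.integral_add (f := fun ρ => Poly.eval p ρ ^ 2) (g := fun _ => K)
      (((Poly.continuous_eval p).pow 2).intervalIntegrable _ _) (continuous_const.intervalIntegrable _ _),
      intervalIntegral.integral_const, smul_eq_mul]
    have hp2 : ∫ ρ in (a : ℝ)..b, Poly.eval p ρ ^ 2 =
        Poly.eval (Poly.ad 0 (Poly.mul p p)) b - Poly.eval (Poly.ad 0 (Poly.mul p p)) a := by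
      rw [← integral_eq_sub_of_hasDerivAt (fun x _ => hasDerivAt_eval_ad_zero (Poly.mul p p) x)
        ((Poly.continuous_eval _).intervalIntegrable _ _)]
      exact intervalIntegral.integral_congr fun ρ _ => by simp only [Poly.eval_mul, pow_two]
    rw [hp2, sqIntegSubLocQ, hK, hAdef, hδ]
    have e1 := Poly.eval_evalQ (Poly.ad 0 (Poly.mul p p)) b
    have e2 := Poly.eval_evalQ (Poly.ad 0 (Poly.mul p p)) a
    push_cast
    linarith [e1, e2]
  exact (h1.trans h2).trans h3.le

/-- **Panel with an enclosed breakpoint, localised error terms.** [folklore] -/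
theorem integral_sq_split_le_Ioo_loc {S : ℕ} (hS : 0 < S) {h : ℚ} (h0 : 0 ≤ h) {R RA RB : ℝ → ℝ} {PA PB : IPoly}
    (hA : TMem S h RA PA) (hB : TMem S h RB PB) (pA pB : Poly) {β : ℝ} {bm bp : ℚ}
    (hbm : -h ≤ bm) (hbmβ : (bm : ℝ) ≤ β) (hβbp : β ≤ bp) (hbp : bp ≤ h)
    (hRA : ∀ ρ ∈ Ioo (-(h : ℝ)) β, R ρ = RA ρ) (hRB : ∀ ρ ∈ Ioo β h, R ρ = RB ρ)
    (hRi : IntervalIntegrable (fun ρ => R ρ ^ 2) volume (-(h : ℝ)) h) :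
    ∫ ρ in (-(h : ℝ))..h, R ρ ^ 2 ≤
      ((sqIntegSubLocQ S h PA pA (-h) bp : ℚ) : ℝ) + ((sqIntegSubLocQ S h PB pB bm h : ℚ) : ℝ) := by
  have hbm' : (-(h : ℝ)) ≤ bm := by exact_mod_cast hbm
  have hbp' : ((bp : ℚ) : ℝ) ≤ h := by exact_mod_cast hbp
  have hβ1 : -(h : ℝ) ≤ β := hbm'.trans hbmβ
  have hβ2 : β ≤ h := hβbp.trans hbp'
  have hIA : IntervalIntegrable (fun ρ => R ρ ^ 2) volume (-(h : ℝ)) β :=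
    hRi.mono_set (by rw [uIcc_of_le hβ1, uIcc_of_le (hβ1.trans hβ2)]; exact Icc_subset_Icc le_rfl hβ2)
  have hIB : IntervalIntegrable (fun ρ => R ρ ^ 2) volume β h :=
    hRi.mono_set (by rw [uIcc_of_le hβ2, uIcc_of_le (hβ1.trans hβ2)]; exact Icc_subset_Icc hβ1 le_rfl)
  rw [← integral_add_adjacent_intervals hIA hIB]
  refine add_le_add ?_ ?_
  · have := integral_sq_branch_le_Ioo_loc hS h0 hA pA (a := -h) (b := bp) (by push_cast; exact le_rfl)
      (by push_cast; exact le_rfl) hβ1 hβbp hbp' hRA hIA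
    simpa using this
  · exact integral_sq_branch_le_Ioo_loc hS h0 hB pB (a := bm) (b := h) hbm' hbmβ hβ2 le_rfl le_rfl hRB hIB

end PolyMP

end Literature.Analysis.ValidatedNumerics
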